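import Summits.Ventures.HodgeRepro2.T5CyclotomicSevenInertThree
import Summits.Ventures.HodgeRepro2.T5RecordSatakeSplitToy

/-!
# The prime `2` of `ℚ(ζ₇)⁺` has two places of `ℚ(ζ₇)` above it, and the record's Hecke algebra there is commutative

Tier-5 support N3 / §G-N4.2 (seat p3, gen 78). The SPLIT branch of the record's census (files 231 / 234 / 250: two
distinct places of the CM field `K` over a place `v` of `K⁺` make `H(U(1 ⊗ H), K_v)` commutative) is inhabited on
`ℚ(i)` at `5` (file 250). This file inhabits it on the FIELD OF RECORD `ℚ(ζ₇)`: the prime `2` has order `3` modulo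
`7`, so every prime `P` of `𝓞_{ℚ(ζ₇)}` above `2` has `f(P/2) = 3`, `e(P/2) = 1`, `N(P) = 8`; its contraction `v` to
`ℚ(ζ₇)⁺` has `f(P/v) = 1` (`f(P/v)` divides `3` and is at most `2`), hence `f(v/2) = 3`, `N(v) = 8 = N((2))`, so
`v = (2)` is a prime of `𝓞_{ℚ(ζ₇)⁺}` (file 253's norm argument); `e(P/v) = 1` by the tower law, so the local degree
`[K_P : K⁺_v] = e f = 1` and `v` has exactly TWO places above it (file T5FinitePlaceSplitIff) — all from Mathlib's
cyclotomic inertia-degree / ramification theorems and the tower laws, with no prime exhibited by hand: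

* `orderOf_two_zmod_seven`, `finrank_rat_maximalRealSubfield_seven` (`[ℚ(ζ₇)⁺ : ℚ] = 3`), `absNorm_span_two_plus`;
* `inertiaDeg_of_liesOver_two`, `ramificationIdx_of_liesOver_two`, `absNorm_of_liesOver_two` — `f = 3`, `e = 1`,
  `N(P) = 8` for every prime `P` above `2`;
* `wOf` / `vOf` — `P` and its contraction as places; **`inertiaDeg_under_eq_one`**, `inertiaDeg_under_int`,
  **`under_eq_span_two`** — the contraction IS `(2)`;
* **`isPrime_span_two_plus`**, `vTwoSeven` — the place `(2)` of `ℚ(ζ₇)⁺`; `absNorm_vTwoSeven` — `N(v) = 8`;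
* `ramificationIdx_under_eq_one`, `ncard_primesOver_vOf`, **`ncard_primesOver_vTwoSeven`** — exactly two places
  of `ℚ(ζ₇)` above `(2)`; `exists_ne_liesOver_vTwoSeven`;
* **`heckeAlgebra_mul_comm_record_seven_two`** — `H(U(1 ⊗ H₀), K_{(2)})` is commutative on `ℚ(ζ₇)`, for every
  family `l` of generators and every field `k`; `exists_generators_and_…` — with `l` supplied by file 235.

§8(d): uses an L-value-free non-vanishing device: NO.
-/

open Matrix NumberField NumberField.IsCMField IsDedekindDomain IsDedekindDomain.HeightOneSpectrum Module
open scoped TensorProduct Pointwise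
open Summit.Ventures.HodgeRepro2.T5UnitaryGroupForm Summit.Ventures.HodgeRepro2.T5UnitaryHeckeAdjoint
  Summit.Ventures.HodgeRepro2.T5HeckePermutationModule Summit.Ventures.HodgeRepro2.T5RecordHyperspecial
  Summit.Ventures.HodgeRepro2.T5GlobalLatticeAlmostAll Summit.Ventures.HodgeRepro2.T5FinitePlaceSplitClassification
  Summit.Ventures.HodgeRepro2.T5RecordSatakeToy Summit.Ventures.HodgeRepro2.T5RecordSatakeSplitToy
  Summit.Ventures.HodgeRepro2.T5CyclotomicSevenInertThree Summit.Ventures.HodgeRepro2.T5CMFieldSquareDatum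
  Summit.Ventures.HodgeRepro2.T5FinitePlaceSplitIff Summit.Ventures.HodgeRepro2.T5SplitPlaceUnitaryGroup
  Summit.Ventures.HodgeRepro2.T5RecordSatakeInert Summit.Ventures.HodgeRepro2.T5FinitePlaceCM

namespace Summit.Ventures.HodgeRepro2.T5CyclotomicSevenSplitTwo

section Arithmetic

/-- `2` has multiplicative order `3` modulo `7`. -/
theorem orderOf_two_zmod_seven : orderOf (2 : ZMod 7) = 3 := by
  rw [orderOf_eq_iff (by norm_num)]
  decide

/-- `N((2)) = 2` in `ℤ`. -/
theorem absNorm_span_two_int : Ideal.absNorm (Ideal.span {(2 : ℤ)}) = 2 := by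
  have h := Ideal.absNorm_span_natCast (S := ℤ) 2
  rw [Nat.cast_ofNat, Module.finrank_self, pow_one] at h
  exact h

end Arithmetic

section Seven

variable (K : Type*) [Field K] [CharZero K] [IsCyclotomicExtension {7} ℚ K]

/-- `[ℚ(ζ₇)⁺ : ℚ] = 3` (the tower law with `[ℚ(ζ₇) : ℚ(ζ₇)⁺] = 2` and `[ℚ(ζ₇) : ℚ] = 6`). -/
theorem finrank_rat_maximalRealSubfield_seven :
    haveI := numberField' K; haveI := isCMField' K
    Module.finrank ℚ (maximalRealSubfield K) = 3 := by
  haveI := numberField' K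
  haveI := isCMField' K
  have h := Module.finrank_mul_finrank ℚ (maximalRealSubfield K) K
  rw [Algebra.IsQuadraticExtension.finrank_eq_two (maximalRealSubfield K) K, finrank_rat_seven K] at h
  omega

/-- `N((2)) = 2³ = 8` in `𝓞_{ℚ(ζ₇)⁺}`. -/
theorem absNorm_span_two_plus :
    haveI := numberField' K; haveI := isCMField' K
    Ideal.absNorm (Ideal.span {(2 : 𝓞 (maximalRealSubfield K))}) = 8 := by
  haveI := numberField' K
  haveI := isCMField' K
  have h := Ideal.absNorm_span_natCast (S := 𝓞 (maximalRealSubfield K)) 2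
  rw [Nat.cast_ofNat, RingOfIntegers.rank, finrank_rat_maximalRealSubfield_seven K] at h
  exact h

variable (P : Ideal (𝓞 K)) [P.IsPrime] [P.LiesOver (Ideal.span {(2 : ℤ)})]

/-- Every prime of `𝓞_{ℚ(ζ₇)}` above `2` has inertia degree `orderOf (2 mod 7) = 3` (Mathlib). -/
theorem inertiaDeg_of_liesOver_two :
    haveI := numberField' K
    P.inertiaDeg ℤ = 3 := by
  haveI := numberField' K
  rw [IsCyclotomicExtension.Rat.inertiaDeg_eq_of_not_dvd (m := 7) 2 K P (by norm_num), Nat.cast_ofNat,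
    orderOf_two_zmod_seven]

/-- Every prime of `𝓞_{ℚ(ζ₇)}` above `2` is unramified over `ℤ` (Mathlib). -/
theorem ramificationIdx_of_liesOver_two :
    haveI := numberField' K
    P.ramificationIdx ℤ = 1 := by
  haveI := numberField' K
  exact IsCyclotomicExtension.Rat.ramificationIdx_eq_of_not_dvd (m := 7) 2 K P (by norm_num)

/-- Every prime of `𝓞_{ℚ(ζ₇)}` above `2` has norm `2³ = 8`. -/
theorem absNorm_of_liesOver_two :
    haveI := numberField' K
    Ideal.absNorm P = 8 := by
  haveI := numberField' K
  have h := Ideal.absNorm_pow_inertiaDeg (Ideal.span {(2 : ℤ)}) P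
  rw [absNorm_span_two_int, inertiaDeg_of_liesOver_two K P] at h
  exact h.symm

omit [CharZero K] [IsCyclotomicExtension {7} ℚ K] [P.IsPrime] in
/-- `2 ∈ P`. -/
theorem two_mem_of_liesOver_two : (2 : 𝓞 K) ∈ P := by
  have h2 : (2 : ℤ) ∈ Ideal.span {(2 : ℤ)} := Ideal.mem_span_singleton_self 2
  rw [Ideal.mem_of_liesOver P (Ideal.span {(2 : ℤ)}) 2, map_ofNat] at h2
  exact h2

omit [CharZero K] [IsCyclotomicExtension {7} ℚ K] [P.IsPrime] in
/-- `2 ∈ P ∩ 𝓞_{ℚ(ζ₇)⁺}`. -/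
theorem two_mem_under_of_liesOver_two : (2 : 𝓞 (maximalRealSubfield K)) ∈ P.under (𝓞 (maximalRealSubfield K)) := by
  rw [Ideal.mem_under, map_ofNat]
  exact two_mem_of_liesOver_two K P

/-- A prime `P` above `2` as a place of `ℚ(ζ₇)`. -/
noncomputable def wOf : HeightOneSpectrum (𝓞 K) where
  asIdeal := P
  isPrime := inferInstance
  ne_bot := fun h => by
    have h2 := two_mem_of_liesOver_two K P
    rw [h, Ideal.mem_bot] at h2
    exact two_ne_zero h2

/-- The contraction of `P` as a place of `ℚ(ζ₇)⁺`. -/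
noncomputable def vOf : HeightOneSpectrum (𝓞 (maximalRealSubfield K)) where
  asIdeal := P.under (𝓞 (maximalRealSubfield K))
  isPrime := inferInstance
  ne_bot := fun h => by
    have h2 := two_mem_under_of_liesOver_two K P
    rw [h, Ideal.mem_bot] at h2
    exact two_ne_zero h2

omit [IsCyclotomicExtension {7} ℚ K] in
/-- The ideal of `wOf`. -/
theorem wOf_asIdeal : (wOf K P).asIdeal = P := rfl

omit [IsCyclotomicExtension {7} ℚ K] in
/-- The ideal of `vOf`. -/
theorem vOf_asIdeal : (vOf K P).asIdeal = P.under (𝓞 (maximalRealSubfield K)) := rfl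

/-- `wOf` lies over `vOf`. -/
instance liesOver_vOf : (wOf K P).asIdeal.LiesOver (vOf K P).asIdeal := ⟨rfl⟩

/-- **`f(P/v) = 1`**: `3 = f(P/2) = f(v/2) · f(P/v)` (the tower law), so `f(P/v) ∈ {1, 3}`, and `f(P/v)` divides
the local degree `[K_P : K⁺_v]`, which divides `[K : K⁺] = 2`. -/
theorem inertiaDeg_under_eq_one :
    haveI := numberField' K; haveI := isCMField' K
    (wOf K P).asIdeal.inertiaDeg (𝓞 (maximalRealSubfield K)) = 1 := by
  haveI := numberField' K
  haveI := isCMField' K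
  have htower := Ideal.inertiaDeg_tower (R := ℤ) (vOf K P).asIdeal (wOf K P).asIdeal
  have h3 : (wOf K P).asIdeal.inertiaDeg ℤ = 3 := inertiaDeg_of_liesOver_two K P
  rw [h3] at htower
  have hdvd : (wOf K P).asIdeal.inertiaDeg (𝓞 (maximalRealSubfield K)) ∣ 3 := ⟨_, by rw [htower, mul_comm]⟩
  rcases Nat.prime_three.eq_one_or_self_of_dvd _ hdvd with h | h
  · exact h
  · exfalso
    obtain ⟨θ, y, hθ, hy⟩ := exists_sq_eq_and_complexConj_ne K
    have hef := ramificationIdx_mul_inertiaDeg_eq_finrank K (vOf K P) (wOf K P) hθ hy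
    have h2 := ncard_primesOver_mul_finrank_eq_two K (vOf K P) (wOf K P) hθ hy
    have h3 : 3 ∣ 2 := by
      refine dvd_trans ?_ ⟨_, h2.symm.trans (mul_comm _ _)⟩
      rw [← hef, h]
      exact dvd_mul_left 3 _
    norm_num at h3

/-- `f(v/2) = 3`. -/
theorem inertiaDeg_under_int :
    haveI := numberField' K; haveI := isCMField' K
    (vOf K P).asIdeal.inertiaDeg ℤ = 3 := by
  haveI := numberField' K
  haveI := isCMField' K
  have htower := Ideal.inertiaDeg_tower (R := ℤ) (vOf K P).asIdeal (wOf K P).asIdeal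
  have h3 : (wOf K P).asIdeal.inertiaDeg ℤ = 3 := inertiaDeg_of_liesOver_two K P
  rw [h3, inertiaDeg_under_eq_one K P, mul_one] at htower
  exact htower.symm

/-- `N(v) = 2³ = 8` for the contraction `v` of a prime above `2`. -/
theorem absNorm_under :
    haveI := numberField' K; haveI := isCMField' K
    Ideal.absNorm (vOf K P).asIdeal = 8 := by
  haveI := numberField' K
  haveI := isCMField' K
  haveI : (vOf K P).asIdeal.LiesOver (Ideal.span {(2 : ℤ)}) := by
    rw [vOf_asIdeal]
    exact Ideal.LiesOver.tower_bot P (P.under (𝓞 (maximalRealSubfield K))) (Ideal.span {(2 : ℤ)})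
  have h := Ideal.absNorm_pow_inertiaDeg (Ideal.span {(2 : ℤ)}) (vOf K P).asIdeal
  rw [absNorm_span_two_int, inertiaDeg_under_int K P] at h
  exact h.symm

/-- **The contraction of every prime above `2` is `(2)`**: `(2) ≤ v` and both have norm `8`. -/
theorem under_eq_span_two :
    haveI := numberField' K; haveI := isCMField' K
    (vOf K P).asIdeal = Ideal.span {(2 : 𝓞 (maximalRealSubfield K))} := by
  haveI := numberField' K
  haveI := isCMField' K
  refine (eq_of_le_of_absNorm_eq ?_ ((Ideal.span_singleton_eq_bot).not.mpr (by norm_num)) ?_).symm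
  · rw [Ideal.span_le, Set.singleton_subset_iff, SetLike.mem_coe, vOf_asIdeal]
    exact two_mem_under_of_liesOver_two K P
  · rw [absNorm_span_two_plus K, absNorm_under K P]

end Seven

section Place

variable (K : Type*) [Field K] [CharZero K] [IsCyclotomicExtension {7} ℚ K]

/-- **`(2)` is a prime of `𝓞_{ℚ(ζ₇)⁺}`**: it is the contraction of any prime of `𝓞_{ℚ(ζ₇)}` above `2`. -/
theorem isPrime_span_two_plus :
    haveI := numberField' K; haveI := isCMField' K
    (Ideal.span {(2 : 𝓞 (maximalRealSubfield K))}).IsPrime := by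
  haveI := numberField' K
  haveI := isCMField' K
  haveI : (Ideal.span {(2 : ℤ)}).IsPrime := (Ideal.span_singleton_prime (by norm_num)).mpr Int.prime_two
  obtain ⟨⟨P, hP, hPo⟩⟩ := Ideal.nonempty_primesOver (S := 𝓞 K) (Ideal.span {(2 : ℤ)})
  rw [← under_eq_span_two K P]
  exact (vOf K P).isPrime

/-- **The place `(2)` of `ℚ(ζ₇)⁺`.** -/
noncomputable def vTwoSeven : HeightOneSpectrum (𝓞 (maximalRealSubfield K)) :=
  haveI := numberField' K
  haveI := isCMField' K
  { asIdeal := Ideal.span {(2 : 𝓞 (maximalRealSubfield K))}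
    isPrime := isPrime_span_two_plus K
    ne_bot := (Ideal.span_singleton_eq_bot).not.mpr (by norm_num) }

/-- The ideal of `vTwoSeven` is `(2)`. -/
theorem vTwoSeven_asIdeal : (vTwoSeven K).asIdeal = Ideal.span {(2 : 𝓞 (maximalRealSubfield K))} := rfl

/-- `N(vTwoSeven) = 8`. -/
theorem absNorm_vTwoSeven :
    haveI := numberField' K; haveI := isCMField' K
    Ideal.absNorm (vTwoSeven K).asIdeal = 8 := by
  haveI := numberField' K
  haveI := isCMField' K
  rw [vTwoSeven_asIdeal]
  exact absNorm_span_two_plus K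

variable (P : Ideal (𝓞 K)) [P.IsPrime] [P.LiesOver (Ideal.span {(2 : ℤ)})]

/-- **`e(P/v) = 1`**: `1 = e(P/2) = e(v/2) · e(P/v)` (the tower law, `𝓞_{ℚ(ζ₇)}` being flat over the Dedekind domain
`𝓞_{ℚ(ζ₇)⁺}`). -/
theorem ramificationIdx_under_eq_one :
    haveI := numberField' K; haveI := isCMField' K
    (wOf K P).asIdeal.ramificationIdx (𝓞 (maximalRealSubfield K)) = 1 := by
  haveI := numberField' K
  haveI := isCMField' K
  have htower := Ideal.ramificationIdx_tower (R := ℤ) (vOf K P).asIdeal (wOf K P).asIdeal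
  have h1 : (wOf K P).asIdeal.ramificationIdx ℤ = 1 := ramificationIdx_of_liesOver_two K P
  rw [h1] at htower
  exact Nat.eq_one_of_mul_eq_one_left htower.symm

/-- **Exactly two places of `ℚ(ζ₇)` above the contraction of a prime above `2`**: the local degree
`[K_P : K⁺_v] = e(P/v) f(P/v) = 1`, and a local degree `1` means two places (file T5FinitePlaceSplitIff). -/
theorem ncard_primesOver_vOf :
    haveI := numberField' K; haveI := isCMField' K
    ((vOf K P).asIdeal.primesOver (𝓞 K)).ncard = 2 := by
  haveI := numberField' K
  haveI := isCMField' K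
  obtain ⟨θ, y, hθ, hy⟩ := exists_sq_eq_and_complexConj_ne K
  refine (finrank_eq_one_iff_ncard_primesOver_eq_two K (vOf K P) (wOf K P) hθ hy).mp ?_
  rw [← ramificationIdx_mul_inertiaDeg_eq_finrank K (vOf K P) (wOf K P) hθ hy, ramificationIdx_under_eq_one K P,
    inertiaDeg_under_eq_one K P]

omit P in
/-- **Exactly two places of `ℚ(ζ₇)` above `(2)`.** -/
theorem ncard_primesOver_vTwoSeven :
    haveI := numberField' K; haveI := isCMField' K
    ((vTwoSeven K).asIdeal.primesOver (𝓞 K)).ncard = 2 := by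
  haveI := numberField' K
  haveI := isCMField' K
  haveI : (Ideal.span {(2 : ℤ)}).IsPrime := (Ideal.span_singleton_prime (by norm_num)).mpr Int.prime_two
  obtain ⟨⟨P, hP, hPo⟩⟩ := Ideal.nonempty_primesOver (S := 𝓞 K) (Ideal.span {(2 : ℤ)})
  rw [vTwoSeven_asIdeal, ← under_eq_span_two K P]
  exact ncard_primesOver_vOf K P

omit P in
/-- Two distinct places of `ℚ(ζ₇)` lie over `vTwoSeven`. -/
theorem exists_ne_liesOver_vTwoSeven :
    haveI := numberField' K; haveI := isCMField' K
    ∃ w₁ w₂ : HeightOneSpectrum (𝓞 K), w₁ ≠ w₂ ∧ w₁.asIdeal.LiesOver (vTwoSeven K).asIdeal ∧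
      w₂.asIdeal.LiesOver (vTwoSeven K).asIdeal := by
  haveI := numberField' K
  haveI := isCMField' K
  obtain ⟨x, z, hxz, hs⟩ := Set.ncard_eq_two.mp (ncard_primesOver_vTwoSeven K)
  have hx : x ∈ (vTwoSeven K).asIdeal.primesOver (𝓞 K) := by rw [hs]; exact Set.mem_insert x _
  have hz : z ∈ (vTwoSeven K).asIdeal.primesOver (𝓞 K) := by rw [hs]; exact Set.mem_insert_of_mem x rfl
  haveI := hx.1
  haveI := hx.2
  haveI := hz.1
  haveI := hz.2
  refine ⟨⟨x, hx.1, Ideal.ne_bot_of_liesOver_of_ne_bot (vTwoSeven K).ne_bot x⟩,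
    ⟨z, hz.1, Ideal.ne_bot_of_liesOver_of_ne_bot (vTwoSeven K).ne_bot z⟩, ?_, hx.2, hz.2⟩
  intro h
  exact hxz (congrArg HeightOneSpectrum.asIdeal h)

omit P in
/-- **THE RECORD'S SPHERICAL HECKE ALGEBRA ON `ℚ(ζ₇)` AT THE SPLIT PLACE `(2)` IS COMMUTATIVE**: for every family
`l` of generators of `𝓞_{ℚ(ζ₇)}` over `𝓞_{ℚ(ζ₇)⁺}` and every field `k`, `H(U(1 ⊗ H₀), K_{(2)})` is commutative
(file 250's `heckeAlgebra_mul_comm_record_of_ne_of_liesOver` on the two places above `(2)`). -/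
theorem heckeAlgebra_mul_comm_record_seven_two (k : Type*) [Field k] {r : ℕ} (l : Fin r → 𝓞 K)
    (hl : Submodule.span (𝓞 (maximalRealSubfield K)) (Set.range l) = ⊤)
    (T S : (haveI := numberField' K; haveI := isCMField' K; letI := tensorStarRing K (vTwoSeven K);
      ↥(heckeAlgebra k (recordHyperspecial K (vTwoSeven K) l (gramToy K))))) :
    T * S = S * T :=
  haveI := numberField' K
  haveI := isCMField' K
  (exists_ne_liesOver_vTwoSeven K).elim fun w₁ h => h.elim fun w₂ h =>
    @heckeAlgebra_mul_comm_record_of_ne_of_liesOver K _ (numberField' K) (isCMField' K) (vTwoSeven K) w₁ w₂ _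
      l k _ hl h.1 h.2.1 h.2.2 _ _ _ _ gramToy_isHermitian isUnit_det_gramToy (notMem_badSet_gramToy _) T S

omit P in
/-- **With the generators supplied** (file 235's `exists_fin_span_eq_top`): the split branch of the census is
inhabited on the field of record. -/
theorem exists_generators_and_heckeAlgebra_mul_comm_record_seven_two (k : Type*) [Field k] :
    haveI := numberField' K; haveI := isCMField' K
    ∃ (r : ℕ) (l : Fin r → 𝓞 K), Submodule.span (𝓞 (maximalRealSubfield K)) (Set.range l) = ⊤ ∧
      ∀ T S : (letI := tensorStarRing K (vTwoSeven K);
          ↥(heckeAlgebra k (recordHyperspecial K (vTwoSeven K) l (gramToy K)))), T * S = S * T :=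
  haveI := numberField' K
  haveI := isCMField' K
  (exists_fin_span_eq_top K).elim fun r h => h.elim fun l hl =>
    ⟨r, l, hl, fun T S => heckeAlgebra_mul_comm_record_seven_two K k l hl T S⟩

end Place

end Summit.Ventures.HodgeRepro2.T5CyclotomicSevenSplitTwo
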